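import Literature.Topology.FourManifolds.BoundaryGluingData
import Literature.Topology.FourManifolds.ClosedModelHomology
import HarnessLib

/-!
# Relative homology of a piece of a boundary gluing: `Hₖ(N, ∂N) ≅ Hₖ(M ∪_φ N, M)`

For a closed gluing `P = M ∪_φ N` of two compact smooth manifolds with boundary along a
bijection of their boundaries (witnessed by `Literature.Topology.FourManifolds.BoundaryGluingData`:
smooth embeddings `jA : M → P`, `jB : N → P` covering `P` and meeting exactly along
`∂M ≡_φ ∂N`), the second piece is a map of pairs `jB : (N, ∂N) → (P, jA(M))`, and

* `BoundaryGluingData.isIso_map_jB_boundary` — **`jB_* : Hₖ(N, ∂N; G) ≅ Hₖ(P, jA(M); G)`** for all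
  `k` and all coefficients (Hatcher 2002, §2.1: excision Thm. 2.20 and the deformation argument
  of Prop. 2.22).  Proof: with a collar `κ` of `∂N` and its collar neighbourhoods
  `C_ε = κ(∂N × [0, ε))`, the subset `A_ε = jA(M) ∪ jB(C_ε)` is open in `P` and deformation
  retracts onto `jA(M)` by sliding down the collar lines of `N` (the two prescriptions — slide on
  `jB(C_ε)`, identity on `jA(M)` — agree on the seam, which the slide fixes, and paste along the
  closed cover of `A_ε` by its traces on the two pieces), so `Hₖ(P, jA M) ≅ Hₖ(P, A_ε)`
  (`isIso_map_range_jA_thickening`); likewise `Hₖ(N, ∂N) ≅ Hₖ(N, C_ε)` (the tree's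
  `NullCobordism.isIso_map_boundary_collarNhd`); and both thickened pairs excise to the pairs
  `(N ∖ ∂N, C_ε ∖ ∂N) ≅ (P ∖ jA M, A_ε ∖ jA M)`, which `jB` identifies homeomorphically
  (`isIso_map_jB_collarNhd`).
* `BoundaryGluingData.isIso_map_jA_boundary'` — the same for the first piece,
  `jA_* : Hₖ(M, ∂M) ≅ Hₖ(P, jB(N))` (swap the pieces).

This is the identification `H₂(Mᵢ, ∂Mᵢ) = H₂(M₁ ∪ M₂, Mⱼ)` used silently in the proof of Novikov
additivity of the signature (R. Kirby, *The topology of 4-manifolds*, LNM 1374 (1989), Ch. II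
Thm. 5.3) and the source of the relative fundamental classes of the pieces induced by an
orientation of `P`.  The pieces are null-cobordisms `Literature.Topology.FourManifolds.NullCobordism`
(compact `W` with `∂W ≅` a closed manifold), so that the tree's collar neighbourhoods and collar
slide (`ClosedModelHomology.lean`) apply verbatim.  Everything is proved; no definitions, no named
facts.

## References

* A. Hatcher, *Algebraic Topology*, CUP 2002, §2.1 Thm. 2.20 (excision), Prop. 2.22 (proof:
  deformation retraction of a collar neighbourhood). [HatcherAT2002]
* R. C. Kirby, *The topology of 4-manifolds*, LNM 1374, Springer 1989, Ch. II §5, Thm. 5.3.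
  [Kirby1989]
-/

noncomputable section

open scoped Manifold ContDiff Topology
open Set Function Filter CategoryTheory Limits
open Literature.AlgebraicTopology.SingularHomology

namespace Literature.Topology.FourManifolds

universe v

namespace BoundaryGluingData

variable {m : ℕ}
variable {S : Type} [TopologicalSpace S] [ChartedSpace (EuclideanSpace ℝ (Fin (m + 1))) S]
  [IsManifold (𝓡 (m + 1)) ∞ S]
variable {S' : Type} [TopologicalSpace S'] [ChartedSpace (EuclideanSpace ℝ (Fin (m + 1))) S']
  [IsManifold (𝓡 (m + 1)) ∞ S']
variable {cM : NullCobordism (m + 1) S} {cN : NullCobordism (m + 1) S'} {φ : S ≃ S'}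
variable {P : Type} [TopologicalSpace P] [ChartedSpace (EuclideanSpace ℝ (Fin (m + 1 + 1))) P]
variable (G : BoundaryGluingData cM.boundaryData cN.boundaryData φ P)

/-! ### The pieces as maps of pairs -/

/-- `jB ⁻¹ (jA M) = ∂N`: the second piece meets the first exactly along its boundary. [folklore] -/
theorem preimage_jB_range_jA : G.jB ⁻¹' range G.jA = (𝓡∂ (m + 1 + 1)).boundary cN.W := by
  ext b
  constructor
  · rintro ⟨a, ha⟩
    obtain ⟨z, -, hb⟩ := (G.jA_eq_jB_iff a b).1 ha
    rw [hb]
    exact cN.boundaryData.incl_mem_boundary _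
  · intro hb
    rw [← cN.boundaryData.range_incl] at hb
    obtain ⟨w, rfl⟩ := hb
    exact ⟨cM.boundaryData.incl (φ.symm w), (G.jB_incl w).symm⟩

/-- `jB` is a map of pairs `(N, ∂N) → (P, jA M)`. [folklore] -/
theorem mapsTo_jB_boundary : MapsTo G.jB ((𝓡∂ (m + 1 + 1)).boundary cN.W) (range G.jA) :=
  fun b hb => by rw [← mem_preimage, G.preimage_jB_range_jA]; exact hb

/-- `jA` is a map of pairs `(M, ∂M) → (P, jB N)`. [folklore] -/
theorem mapsTo_jA_boundary : MapsTo G.jA ((𝓡∂ (m + 1 + 1)).boundary cM.W) (range G.jB) :=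
  G.symm.mapsTo_jB_boundary

/-- `jB` maps `N ∖ ∂N` onto `P ∖ jA M`. [folklore] -/
theorem image_jB_compl_boundary :
    G.jB '' ((𝓡∂ (m + 1 + 1)).boundary cN.W)ᶜ = (range G.jA)ᶜ := by
  rw [ModelWithCorners.compl_boundary]
  exact G.symm.image_jA_interior_eq_compl

/-! ### The thickening `A_ε = jA(M) ∪ jB(C_ε)` -/

variable (κ : cN.boundaryData.Collar)

/-- `jB ⁻¹ A_ε = C_ε` for the thickening `A_ε = jA(M) ∪ jB(C_ε)` (for `ε > 0`, since `∂N ⊆ C_ε`).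
[folklore] -/
theorem preimage_jB_thickening {ε : ℝ} (hε : 0 < ε) :
    G.jB ⁻¹' (range G.jA ∪ G.jB '' cN.collarNhd κ ε) = cN.collarNhd κ ε := by
  rw [preimage_union, preimage_jB_range_jA, G.injective_jB.preimage_image, union_eq_right]
  exact cN.boundary_subset_collarNhd κ hε

/-- `jB` is a map of pairs `(N, C_ε) → (P, A_ε)`. [folklore] -/
theorem mapsTo_jB_collarNhd (ε : ℝ) :
    MapsTo G.jB (cN.collarNhd κ ε) (range G.jA ∪ G.jB '' cN.collarNhd κ ε) :=
  fun b hb => Or.inr ⟨b, hb, rfl⟩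

/-- The trace of `A_ε` on the second piece is `jB(C_ε)` (for `ε > 0`). [folklore] -/
theorem thickening_inter_range_jB {ε : ℝ} (hε : 0 < ε) :
    (range G.jA ∪ G.jB '' cN.collarNhd κ ε) ∩ range G.jB = G.jB '' cN.collarNhd κ ε := by
  rw [← image_preimage_eq_inter_range, G.preimage_jB_thickening κ hε]

/-- The trace of `A_ε` off the first piece is `jB(C_ε ∖ ∂N)`. [folklore] -/
theorem thickening_inter_compl_range_jA (ε : ℝ) :
    (range G.jA ∪ G.jB '' cN.collarNhd κ ε) ∩ (range G.jA)ᶜ =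
      G.jB '' (cN.collarNhd κ ε ∩ ((𝓡∂ (m + 1 + 1)).boundary cN.W)ᶜ) := by
  rw [union_inter_distrib_right, inter_compl_self, empty_union, image_inter G.injective_jB,
    image_jB_compl_boundary]

variable [IsManifold (𝓡 (m + 1 + 1)) ∞ P]

/-- **`A_ε` is open** for `0 < ε ≤ 1`: its traces `jA ⁻¹ A_ε = M` and `jB ⁻¹ A_ε = C_ε` on the two
(closed) pieces are open. [folklore] -/
theorem isOpen_thickening {ε : ℝ} (hε : 0 < ε) (hε1 : ε ≤ 1) :
    IsOpen (range G.jA ∪ G.jB '' cN.collarNhd κ ε) := by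
  refine G.isOpen_of_preimage ?_ ?_
  · have : G.jA ⁻¹' (range G.jA ∪ G.jB '' cN.collarNhd κ ε) = univ :=
      eq_univ_of_forall fun a => Or.inl ⟨a, rfl⟩
    rw [this]
    exact isOpen_univ
  · rw [G.preimage_jB_thickening κ hε]
    exact cN.isOpen_collarNhd κ hε1

/-! ### Excision on both sides -/

variable (R : Type v) [CommRing R] (Gr : Type v) [AddCommGroup Gr] [Module R Gr]

/-- **Excision off the first piece**: `Hₖ(P ∖ jA M, A_ε ∖ jA M) ≅ Hₖ(P, A_ε)` for `0 < ε ≤ 1`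
(Hatcher 2002, Thm. 2.20: `jA M` is closed and lies in the open `A_ε`). [cite: HatcherAT2002, Thm. 2.20] -/
theorem isIso_map_subsetIncl_compl_range_jA {ε : ℝ} (hε : 0 < ε) (hε1 : ε ≤ 1) (k : ℕ) :
    IsIso (relativeSingularHomology.map R Gr (subsetIncl ((range G.jA)ᶜ))
      (mapsTo_preimage Subtype.val (range G.jA ∪ G.jB '' cN.collarNhd κ ε) :
        MapsTo _ (Subtype.val ⁻¹' (range G.jA ∪ G.jB '' cN.collarNhd κ ε))
          (range G.jA ∪ G.jB '' cN.collarNhd κ ε)) k) := by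
  refine relativeSingularHomology.isIso_map_of_closure_subset_interior_holds R Gr P ?_ k
  rw [G.isClosed_range_jA.closure_eq, (G.isOpen_thickening κ hε hε1).interior_eq]
  exact subset_union_left

/-- **`jB` induces `Hₖ(N, C_ε) ≅ Hₖ(P, A_ε)`** for `0 < ε ≤ 1`: both sides excise to the pairs
`(N ∖ ∂N, C_ε ∖ ∂N)`, `(P ∖ jA M, A_ε ∖ jA M)`, which `jB` identifies homeomorphically (an
embedding is a homeomorphism onto its image, and `jB(N ∖ ∂N) = P ∖ jA M`).
[cite: HatcherAT2002, §2.1, Thm. 2.20 and Prop. 2.22 (proof)] -/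
theorem isIso_map_jB_collarNhd {ε : ℝ} (hε : 0 < ε) (hε1 : ε ≤ 1) (k : ℕ) :
    IsIso (relativeSingularHomology.map R Gr (⟨G.jB, G.continuous_jB⟩ : C(cN.W, P))
      (G.mapsTo_jB_collarNhd κ ε) k) := by
  -- `jB : N ∖ ∂N ≅ P ∖ jA M` as a homeomorphism of pairs
  let e : ↥(((𝓡∂ (m + 1 + 1)).boundary cN.W)ᶜ) ≃ₜ ↥((range G.jA)ᶜ) :=
    ((G.isSmoothEmbedding_jB.isEmbedding.comp Topology.IsEmbedding.subtypeVal).toHomeomorph).trans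
      (Homeomorph.setCongr (by
        rw [show (G.jB ∘ (Subtype.val : ↥(((𝓡∂ (m + 1 + 1)).boundary cN.W)ᶜ) → cN.W)) =
            fun x => G.jB x.1 from rfl, ← image_eq_range]
        exact G.image_jB_compl_boundary))
  have he_apply : ∀ x, (e x : P) = G.jB x.1 := fun x => rfl
  have hsq : (subsetIncl ((range G.jA)ᶜ)).comp
        (e : C(↥(((𝓡∂ (m + 1 + 1)).boundary cN.W)ᶜ), ↥((range G.jA)ᶜ))) =
      (⟨G.jB, G.continuous_jB⟩ : C(cN.W, P)).comp
        (subsetIncl (((𝓡∂ (m + 1 + 1)).boundary cN.W)ᶜ)) := by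
    ext x
    rfl
  have he : MapsTo e (Subtype.val ⁻¹' cN.collarNhd κ ε)
      (Subtype.val ⁻¹' (range G.jA ∪ G.jB '' cN.collarNhd κ ε)) := fun x hx =>
    Or.inr ⟨x.1, hx, rfl⟩
  have he' : MapsTo e.symm (Subtype.val ⁻¹' (range G.jA ∪ G.jB '' cN.collarNhd κ ε))
      (Subtype.val ⁻¹' cN.collarNhd κ ε) := by
    intro y hy
    obtain ⟨x, rfl⟩ := e.surjective y
    rw [Homeomorph.symm_apply_apply]
    have hy' : (e x : P) ∈ (range G.jA ∪ G.jB '' cN.collarNhd κ ε) ∩ (range G.jA)ᶜ :=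
      ⟨hy, (e x).2⟩
    rw [G.thickening_inter_compl_range_jA κ ε, he_apply, G.injective_jB.mem_set_image] at hy'
    exact hy'.1
  -- the square `excision_N ≫ jB_* = e_* ≫ excision_P`
  have hcomm : relativeSingularHomology.map R Gr (subsetIncl (((𝓡∂ (m + 1 + 1)).boundary cN.W)ᶜ))
        (mapsTo_preimage Subtype.val (cN.collarNhd κ ε) :
          MapsTo _ (Subtype.val ⁻¹' cN.collarNhd κ ε) (cN.collarNhd κ ε)) k ≫
      relativeSingularHomology.map R Gr (⟨G.jB, G.continuous_jB⟩ : C(cN.W, P))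
        (G.mapsTo_jB_collarNhd κ ε) k =
      relativeSingularHomology.map R Gr
        (e : C(↥(((𝓡∂ (m + 1 + 1)).boundary cN.W)ᶜ), ↥((range G.jA)ᶜ))) he k ≫
      relativeSingularHomology.map R Gr (subsetIncl ((range G.jA)ᶜ))
        (mapsTo_preimage Subtype.val (range G.jA ∪ G.jB '' cN.collarNhd κ ε) :
          MapsTo _ (Subtype.val ⁻¹' (range G.jA ∪ G.jB '' cN.collarNhd κ ε))
            (range G.jA ∪ G.jB '' cN.collarNhd κ ε)) k := by
    rw [← relativeSingularHomology.map_comp, ← relativeSingularHomology.map_comp]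
    exact relativeSingularHomology.map_congr R Gr hsq.symm _ _ k
  haveI := cN.isIso_map_subsetIncl_compl_boundary κ R Gr hε hε1 k
  haveI := G.isIso_map_subsetIncl_compl_range_jA κ R Gr hε hε1 k
  haveI := relativeSingularHomology.isIso_map_homeomorph R Gr e he he' k
  have hfac : relativeSingularHomology.map R Gr (⟨G.jB, G.continuous_jB⟩ : C(cN.W, P))
        (G.mapsTo_jB_collarNhd κ ε) k =
      inv (relativeSingularHomology.map R Gr (subsetIncl (((𝓡∂ (m + 1 + 1)).boundary cN.W)ᶜ))
        (mapsTo_preimage Subtype.val (cN.collarNhd κ ε) :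
          MapsTo _ (Subtype.val ⁻¹' cN.collarNhd κ ε) (cN.collarNhd κ ε)) k) ≫
      (relativeSingularHomology.map R Gr
        (e : C(↥(((𝓡∂ (m + 1 + 1)).boundary cN.W)ᶜ), ↥((range G.jA)ᶜ))) he k ≫
      relativeSingularHomology.map R Gr (subsetIncl ((range G.jA)ᶜ))
        (mapsTo_preimage Subtype.val (range G.jA ∪ G.jB '' cN.collarNhd κ ε) :
          MapsTo _ (Subtype.val ⁻¹' (range G.jA ∪ G.jB '' cN.collarNhd κ ε))
            (range G.jA ∪ G.jB '' cN.collarNhd κ ε)) k) := by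
    rw [← hcomm, IsIso.inv_hom_id_assoc]
  rw [hfac]
  infer_instance

/-! ### The thickening deformation retracts onto the first piece -/

section Slide

variable [Nonempty S']

/-- **`H₊(A_ε, jA M) = 0`** (`ε > 0`): the thickening `A_ε = jA(M) ∪ jB(C_ε)` deformation
retracts onto the first piece — on `jB(C_ε)` slide down the collar lines of `N`,
`jB(κ(x, t)) ↦ jB(κ(x, (1 - s) t))` (the tree's `NullCobordism.collarSlide` transported by `jB`),
and fix every other point; the two prescriptions agree on the seam `jB(∂N) ⊆ jA(M)`, which the
collar slide fixes, and paste continuously along the closed cover of `[0,1] × A_ε` by the traces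
of the two (closed) pieces (Hatcher 2002, proof of Prop. 2.22, transported into `P`).
[cite: HatcherAT2002, §2.1, Prop. 2.22 (proof)] -/
theorem isZero_rel_thickening_range_jA {ε : ℝ} (hε : 0 < ε) (k : ℕ) :
    IsZero (relativeSingularHomology R Gr (↥(range G.jA ∪ G.jB '' cN.collarNhd κ ε))
      (Subtype.val ⁻¹' range G.jA) k) := by
  classical
  haveI : Nonempty cN.W := ⟨cN.incl (Classical.arbitrary S')⟩
  set A : Set P := range G.jA ∪ G.jB '' cN.collarNhd κ ε with hA
  -- the slide, as a function on `[0,1] × P`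
  set f : unitInterval × P → P := fun q =>
    if q.2 ∈ G.jB '' cN.collarNhd κ ε then
      G.jB (κ ((cN.collarInv κ (G.invB q.2)).1,
        NullCobordism.slide q.1 (cN.collarInv κ (G.invB q.2)).2))
    else q.2 with hf
  have hf_jB : ∀ (s : unitInterval) {b : cN.W} (hb : b ∈ cN.collarNhd κ ε),
      f (s, G.jB b) = G.jB (cN.collarSlide κ ε (s, ⟨b, hb⟩)) := fun s b hb => by
    simp only [hf, if_pos (show G.jB b ∈ G.jB '' cN.collarNhd κ ε from ⟨b, hb, rfl⟩),
      NullCobordism.collarSlide_apply_coe, G.invB_jB]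
  have hf_out : ∀ (s : unitInterval) {p : P}, p ∉ G.jB '' cN.collarNhd κ ε → f (s, p) = p :=
    fun s p hp => by simp only [hf, if_neg hp]
  have hf_fix : ∀ (s : unitInterval) {p : P}, p ∈ range G.jA → f (s, p) = p := by
    intro s p hp
    by_cases h : p ∈ G.jB '' cN.collarNhd κ ε
    · obtain ⟨b, hb, rfl⟩ := h
      have hbd : b ∈ (𝓡∂ (m + 1 + 1)).boundary cN.W := by
        rw [← G.preimage_jB_range_jA]; exact hp
      rw [hf_jB s hb, cN.collarSlide_of_mem_boundary κ ε s ⟨b, hb⟩ hbd]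
    · exact hf_out s h
  have hf_zero : ∀ p : P, f (0, p) = p := by
    intro p
    by_cases h : p ∈ G.jB '' cN.collarNhd κ ε
    · obtain ⟨b, hb, rfl⟩ := h
      rw [hf_jB 0 hb, cN.collarSlide_zero]
    · exact hf_out 0 h
  have hf_one : ∀ {p : P}, p ∈ A → f (1, p) ∈ range G.jA := by
    intro p hp
    by_cases h : p ∈ G.jB '' cN.collarNhd κ ε
    · obtain ⟨b, hb, rfl⟩ := h
      rw [hf_jB 1 hb]
      exact G.mapsTo_jB_boundary (cN.collarSlide_one_mem κ ε ⟨b, hb⟩)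
    · rw [hf_out 1 h]
      exact hp.resolve_right h
  have hf_mem : ∀ (s : unitInterval) {p : P}, p ∈ A → f (s, p) ∈ A := by
    intro s p hp
    by_cases h : p ∈ G.jB '' cN.collarNhd κ ε
    · obtain ⟨b, hb, rfl⟩ := h
      rw [hf_jB s hb]
      exact Or.inr ⟨_, (cN.collarSlide κ ε (s, ⟨b, hb⟩)).2, rfl⟩
    · rw [hf_out s h]
      exact hp
  -- continuity on `[0,1] × A_ε`, by pasting along the closed cover by the two pieces
  have hcont : Continuous fun q : unitInterval × ↥A => f (q.1, q.2.1) := by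
    rw [← continuousOn_univ]
    set T : Set (unitInterval × ↥A) := {q | (q.2 : P) ∈ range G.jA} with hT
    set T' : Set (unitInterval × ↥A) := {q | (q.2 : P) ∈ range G.jB} with hT'
    have hval : Continuous fun q : unitInterval × ↥A => (q.2 : P) :=
      continuous_subtype_val.comp continuous_snd
    have hTc : IsClosed T := G.isClosed_range_jA.preimage hval
    have hT'c : IsClosed T' := G.isClosed_range_jB.preimage hval
    have hcov : T ∪ T' = univ := eq_univ_of_forall fun q =>
      (G.range_union.symm.subset (mem_univ (q.2 : P))).imp id id
    have hmemT' : ∀ q ∈ T', (q.2 : P) ∈ G.jB '' cN.collarNhd κ ε := fun q hq => by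
      rw [← G.thickening_inter_range_jB κ hε]; exact ⟨q.2.2, hq⟩
    rw [← hcov]
    refine ContinuousOn.union_of_isClosed ?_ ?_ hTc hT'c
    · exact hval.continuousOn.congr fun q hq => hf_fix q.1 hq
    · have hinvB : ContinuousOn (fun q : unitInterval × ↥A => G.invB (q.2 : P)) T' :=
        G.continuousOn_invB.comp hval.continuousOn fun q hq => hq
      have hrange : ∀ q ∈ T', G.invB (q.2 : P) ∈ range κ := fun q hq => by
        obtain ⟨b, hb, hbq⟩ := hmemT' q hq
        rw [← hbq, G.invB_jB]
        exact cN.collarNhd_subset_range κ ε hb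
      have hcinv : ContinuousOn
          (fun q : unitInterval × ↥A => cN.collarInv κ (G.invB (q.2 : P))) T' :=
        (cN.continuousOn_collarInv κ).comp hinvB hrange
      have hg : ContinuousOn (fun q : unitInterval × ↥A =>
          G.jB (κ ((cN.collarInv κ (G.invB (q.2 : P))).1,
            NullCobordism.slide q.1 (cN.collarInv κ (G.invB (q.2 : P))).2))) T' := by
        refine G.continuous_jB.comp_continuousOn (κ.continuous.comp_continuousOn ?_)
        refine (continuous_fst.comp_continuousOn hcinv).prodMk ?_
        exact NullCobordism.continuous_slide.comp_continuousOn
          (continuous_fst.continuousOn.prodMk (continuous_snd.comp_continuousOn hcinv))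
      refine hg.congr fun q hq => ?_
      show f (q.1, (q.2 : P)) = _
      simp only [hf, if_pos (hmemT' q hq)]
  -- the deformation of `A_ε` into itself
  let H : C(unitInterval × ↥A, ↥A) :=
    ⟨fun q => ⟨f (q.1, q.2.1), hf_mem q.1 q.2.2⟩, hcont.subtype_mk _⟩
  exact isZero_rel_of_deformation R Gr _ H (fun x => Subtype.ext (hf_zero x.1))
    (fun x => hf_one x.2) (fun s _ hx => Subtype.ext (hf_fix s hx)) k

/-- **`Hₖ(P, jA M) ≅ Hₖ(P, A_ε)`** for `ε > 0` (long exact sequence of the triple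
`jA M ⊆ A_ε ⊆ P` and `H₊(A_ε, jA M) = 0`). [cite: HatcherAT2002, §2.1, Prop. 2.22 (proof)] -/
theorem isIso_map_range_jA_thickening {ε : ℝ} (hε : 0 < ε) (k : ℕ) :
    IsIso (relativeSingularHomology.map R Gr (ContinuousMap.id P)
      (mapsTo_id_of_subset (subset_union_left :
        range G.jA ⊆ range G.jA ∪ G.jB '' cN.collarNhd κ ε)) k) :=
  isIso_map_id_of_isZero_triple R Gr
    (subset_union_left : range G.jA ⊆ range G.jA ∪ G.jB '' cN.collarNhd κ ε)
    (fun j => G.isZero_rel_thickening_range_jA κ R Gr hε j) k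

include κ in
/-- **`jB_* : Hₖ(N, ∂N; G) ≅ Hₖ(M ∪_φ N, jA M; G)`** for all `k` and all coefficients: the second
piece of a boundary gluing, as a map of pairs `(N, ∂N) → (P, jA M)`, induces isomorphisms on
relative homology (Hatcher 2002, §2.1, Thm. 2.20 and proof of Prop. 2.22: thicken both
subspaces by a collar of `∂N`, which changes neither group, and excise down to the homeomorphic
pairs `(N ∖ ∂N, C ∖ ∂N) ≅ (P ∖ jA M, A ∖ jA M)`).  The identification
`H₂(Mᵢ, ∂Mᵢ) = H₂(M₁ ∪ M₂, Mⱼ)` of Kirby 1989, proof of Thm. 5.3.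
[cite: HatcherAT2002, §2.1 Thm. 2.20 and Prop. 2.22] -/
theorem isIso_map_jB_boundary (k : ℕ) :
    IsIso (relativeSingularHomology.map R Gr (⟨G.jB, G.continuous_jB⟩ : C(cN.W, P))
      G.mapsTo_jB_boundary k) := by
  have hε : (0 : ℝ) < 1 := one_pos
  -- `jB_* ≫ (thicken in P) = (thicken in N) ≫ jB_*`
  have hcomm : relativeSingularHomology.map R Gr (⟨G.jB, G.continuous_jB⟩ : C(cN.W, P))
        G.mapsTo_jB_boundary k ≫
      relativeSingularHomology.map R Gr (ContinuousMap.id P)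
        (mapsTo_id_of_subset (subset_union_left :
          range G.jA ⊆ range G.jA ∪ G.jB '' cN.collarNhd κ 1)) k =
      relativeSingularHomology.map R Gr (ContinuousMap.id cN.W)
        (mapsTo_id_of_subset (cN.boundary_subset_collarNhd κ hε)) k ≫
      relativeSingularHomology.map R Gr (⟨G.jB, G.continuous_jB⟩ : C(cN.W, P))
        (G.mapsTo_jB_collarNhd κ 1) k := by
    rw [← relativeSingularHomology.map_comp, ← relativeSingularHomology.map_comp]
    exact relativeSingularHomology.map_congr R Gr
      ((ContinuousMap.id_comp _).trans (ContinuousMap.comp_id _).symm) _ _ k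
  haveI := G.isIso_map_range_jA_thickening κ R Gr hε k
  haveI := cN.isIso_map_boundary_collarNhd κ R Gr hε k
  haveI := G.isIso_map_jB_collarNhd κ R Gr hε le_rfl k
  have hfac : relativeSingularHomology.map R Gr (⟨G.jB, G.continuous_jB⟩ : C(cN.W, P))
        G.mapsTo_jB_boundary k =
      (relativeSingularHomology.map R Gr (ContinuousMap.id cN.W)
        (mapsTo_id_of_subset (cN.boundary_subset_collarNhd κ hε)) k ≫
      relativeSingularHomology.map R Gr (⟨G.jB, G.continuous_jB⟩ : C(cN.W, P))
        (G.mapsTo_jB_collarNhd κ 1) k) ≫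
      inv (relativeSingularHomology.map R Gr (ContinuousMap.id P)
        (mapsTo_id_of_subset (subset_union_left :
          range G.jA ⊆ range G.jA ∪ G.jB '' cN.collarNhd κ 1)) k) := by
    rw [← hcomm, Category.assoc, IsIso.hom_inv_id, Category.comp_id]
  rw [hfac]
  infer_instance

omit κ in
/-- **`jB_* : Hₖ(N, ∂N) ≅ Hₖ(P, jA M)`** without a chosen collar (collars of compact smooth
manifolds with boundary exist, `BoundaryData.nonempty_collar_of_compactSpace`).
[cite: HatcherAT2002, §2.1 Thm. 2.20 and Prop. 2.22] -/
theorem isIso_map_jB_boundary' [CompactSpace S'] [T2Space S'] (k : ℕ) :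
    IsIso (relativeSingularHomology.map R Gr (⟨G.jB, G.continuous_jB⟩ : C(cN.W, P))
      G.mapsTo_jB_boundary k) := by
  obtain ⟨κ⟩ := BoundaryData.nonempty_collar_of_compactSpace m cN.W cN.boundaryData
  exact G.isIso_map_jB_boundary κ R Gr k

omit κ in
omit [Nonempty S'] in
/-- **`jA_* : Hₖ(M, ∂M) ≅ Hₖ(P, jB N)`**: the same for the first piece (swap the pieces).
[cite: HatcherAT2002, §2.1 Thm. 2.20 and Prop. 2.22] -/
theorem isIso_map_jA_boundary' [Nonempty S] [CompactSpace S] [T2Space S] (k : ℕ) :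
    IsIso (relativeSingularHomology.map R Gr (⟨G.jA, G.continuous_jA⟩ : C(cM.W, P))
      G.mapsTo_jA_boundary k) :=
  G.symm.isIso_map_jB_boundary' R Gr k

end Slide

end BoundaryGluingData

end Literature.Topology.FourManifolds

end
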